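import Summits.CriticalPhenomena.PercolationContinuityZ3.Theorems.PercNearOneGluingNoHeavyQuantFiveAtomsHeavy
import HarnessLib

/-!
# QUANT lane R8, T-DEC: the five-atom law at floor `s/4`, regimes `2 < s ≤ 8/3` and `3 ≤ s < 4` (continuation of `…QuantFiveAtomsHeavy`)
# (prim-quant-census-2 gen 80)

builds on p205010 (kernel theorem, internal audit signed; external expert review pending)

Support file (`--supports stmt-CriticalPhenomena-4575`), QUANT lane census seat prim-quant-census-2 (gen 80); memo
`run/shared/lean/prim/quant/prim-quant-census-2-g80/TRIPLE-G80.md` §5.  Theorems only, standard axioms, no sorries, no definitions.  The width-4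
analogue of `…QuantFourAtomsHeavy`: an abstract law `p₀δ₀ + p₁δ_k + p₂δ_{2k} + p₃δ_{3k} + p₄δ_{4k}` (`pᵢ ≥ 0`, `Σ pᵢ = 1`, `p₁+2p₂+3p₃+4p₄ = s`) carries
a HEAVY decomposition (pairs with gate `≥ s/4` and credit `≥ s·k`, self-sufficient points; inline `∃` as in `…QuantHeavyShift`) at floor `s/4`, target
`s·k`.  The only lows are `0` and (for `s > 2`) `k`.  `s ≤ 1`: the zero ships to `k,2k,3k,4k` at the credit gates `s/b`, exactly; `1 < s ≤ 2`: `k` stands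
alone, the zero ships to `2k,3k,4k`; `2 < s ≤ 8/3`: `k → 2k` at the floor gate, zero → `4k` then `3k` (gate `s/3`); `8/3 ≤ s < 3`: `k → 2k` at gate `s−2`
then `3k`, zero → `4k` then `3k`; `3 ≤ s < 4`: zero → `4k`, `k → 3k`.  The capacity hypotheses of the last three regimes are stated explicitly; for the
four-blob weights they are polynomial inequalities in `(c, g)` (`…QuantFourBlobAverageFloor`).

HONEST STATUS.  Tools; `SiblingStep`, `FarTreeRow` OPEN; RATE class (log\*) / honest sentence of `run/shared/lean/prim/quant/README.md` unchanged.
[this work].  Nothing here is cited as a published result.  The gluing rows served [cite: KozmaNitzan2024, Conjecture 3 (p. 15)]; product measure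
[cite: Grimmett1999, §1.3 p. 10].
-/

noncomputable section

open scoped BigOperators

namespace Summit.CriticalPhenomena.PercolationContinuityZ3.Theorems
namespace Quant

open Finset

/-- the two-point law `{lo, hi; g}` (as in `…QuantLawDEC`) -/
local notation3 "TP[" lo ", " hi ", " g ", " h "]" =>
  (g : ℝ) * (if (h : ℕ) = (hi : ℕ) then (1 : ℝ) else 0) + (1 - (g : ℝ)) * (if (h : ℕ) = (lo : ℕ) then (1 : ℝ) else 0)

namespace LawDec

/-! ### Regime `2 < s ≤ 8/3` -/

/-- regime `2 < s ≤ 8/3`: `k → 2k` at the floor gate (credit `2 + s/4 ≥ s`); the zero ships to `4k` at the floor gate and, beyond its capacity,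
to `3k` at gate `s/3`; capacity hypotheses `(s/4)p₁ ≤ (1−s/4)p₂` and `s((s/4)p₀ − (1−s/4)p₄) ≤ (3−s)(s/4)p₃`. [this work] -/
theorem heavy_fiveAtoms_r3lo (k : ℕ) (p₀ p₁ p₂ p₃ p₄ s : ℝ) (hp₀0 : 0 ≤ p₀) (hp₁0 : 0 ≤ p₁) (hp₂0 : 0 ≤ p₂)
    (hp₃0 : 0 ≤ p₃) (hp₄0 : 0 ≤ p₄) (hsum : p₀ + p₁ + p₂ + p₃ + p₄ = 1) (hmean : p₁ + 2 * p₂ + 3 * p₃ + 4 * p₄ = s) (hs0 : 0 < s) (h2 : 2 < s) (h83 : s ≤ 8 / 3)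
    (hC2 : s / 4 * p₁ ≤ (1 - s / 4) * p₂) (hZ : s * (s / 4 * p₀ - (1 - s / 4) * p₄) ≤ (3 - s) * (s / 4) * p₃) :
    ∃ (ι : Type) (_ : Fintype ι) (lam γ : ι → ℝ) (lo hi : ι → ℕ),
      (∀ i, 0 ≤ lam i) ∧ (∑ i, lam i = 1) ∧ (∀ i, 0 ≤ γ i ∧ γ i ≤ 1) ∧ (∀ i, lo i ≤ hi i) ∧ (∀ i, hi i ≤ 4 * k) ∧
      (∀ h, (p₀ * (if h = 0 then (1 : ℝ) else 0) + p₁ * (if h = k then (1 : ℝ) else 0) + p₂ * (if h = 2 * k then (1 : ℝ) else 0)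
          + p₃ * (if h = 3 * k then (1 : ℝ) else 0) + p₄ * (if h = 4 * k then (1 : ℝ) else 0)) = ∑ i, lam i * TP[lo i, hi i, γ i, h]) ∧
      (∀ i, 0 < lam i → s / 4 ≤ γ i ∧ s * k ≤ 2 * (lo i : ℝ) + ((hi i : ℝ) - lo i) * γ i) := by
  have hk0 : (0 : ℝ) ≤ k := Nat.cast_nonneg k
  have hsne : s ≠ 0 := hs0.ne'
  have c2k : ((2 * k : ℕ) : ℝ) = 2 * (k : ℝ) := by push_cast; ring
  have c3k : ((3 * k : ℕ) : ℝ) = 3 * (k : ℝ) := by push_cast; ring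
  have c4k : ((4 * k : ℕ) : ℝ) = 4 * (k : ℝ) := by push_cast; ring
  obtain ⟨x, hx⟩ : ∃ x : ℝ, x = s / 4 := ⟨_, rfl⟩
  have hx0 : 0 < x := by rw [hx]; positivity
  have hx1 : x < 1 := by rw [hx]; linarith
  have h1x : 0 < 1 - x := by linarith
  have hxne : x ≠ 0 := hx0.ne'
  have h1xne : 1 - x ≠ 0 := h1x.ne'
  have hsk4 : s * (k : ℝ) ≤ 4 * k := mul_le_mul_of_nonneg_right (by linarith : s ≤ 4) hk0
  rw [← hx] at hC2 hZ
  have hsk83 : s * (k : ℝ) ≤ 8 / 3 * k := mul_le_mul_of_nonneg_right h83 hk0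
  have h3s : 0 < 3 - s := by linarith
  have h3sne : 3 - s ≠ 0 := h3s.ne'
  have h13 : 0 < 1 - s / 3 := by linarith
  have h13ne : 1 - s / 3 ≠ 0 := h13.ne'
  have hr2 : 0 ≤ p₂ - p₁ / (1 - x) * x := by
    rw [sub_nonneg, div_mul_eq_mul_div, div_le_iff₀ h1x]; linarith
  by_cases hzf : x * p₀ ≤ (1 - x) * p₄
  · have hr4 : 0 ≤ p₄ - p₀ / (1 - x) * x := by
      rw [sub_nonneg, div_mul_eq_mul_div, div_le_iff₀ h1x]; linarith
    refine ⟨Fin 5, inferInstance, ![p₁ / (1 - x), p₀ / (1 - x), p₂ - p₁ / (1 - x) * x, p₃, p₄ - p₀ / (1 - x) * x],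
      ![x, x, 1, 1, 1], ![k, 0, 2 * k, 3 * k, 4 * k], ![2 * k, 4 * k, 2 * k, 3 * k, 4 * k], ?_, ?_, ?_, ?_, ?_, fun h => ?_, ?_⟩
    · intro i; fin_cases i
      · show (0 : ℝ) ≤ p₁ / (1 - x)
        exact div_nonneg hp₁0 h1x.le
      · show (0 : ℝ) ≤ p₀ / (1 - x)
        exact div_nonneg hp₀0 h1x.le
      · show (0 : ℝ) ≤ p₂ - p₁ / (1 - x) * x
        exact hr2
      · show (0 : ℝ) ≤ p₃
        exact hp₃0
      · show (0 : ℝ) ≤ p₄ - p₀ / (1 - x) * x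
        exact hr4
    · rw [Fin.sum_univ_five]
      show (p₁ / (1 - x)) + (p₀ / (1 - x)) + (p₂ - p₁ / (1 - x) * x) + p₃ + (p₄ - p₀ / (1 - x) * x) = 1
      have e : (p₁ / (1 - x)) + (p₀ / (1 - x)) + (p₂ - p₁ / (1 - x) * x) + (p₃) + (p₄ - p₀ / (1 - x) * x) = p₀ + p₁ + p₂ + p₃ + p₄ := by
        field_simp
        ring
      rw [e, hsum]
    · intro i; fin_cases i
      · show (0 : ℝ) ≤ x ∧ x ≤ 1
        exact ⟨hx0.le, hx1.le⟩
      · show (0 : ℝ) ≤ x ∧ x ≤ 1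
        exact ⟨hx0.le, hx1.le⟩
      · show (0 : ℝ) ≤ 1 ∧ 1 ≤ 1
        exact ⟨zero_le_one, le_rfl⟩
      · show (0 : ℝ) ≤ 1 ∧ 1 ≤ 1
        exact ⟨zero_le_one, le_rfl⟩
      · show (0 : ℝ) ≤ 1 ∧ 1 ≤ 1
        exact ⟨zero_le_one, le_rfl⟩
    · intro i; fin_cases i
      · show k ≤ 2 * k; omega
      · exact Nat.zero_le _
      · exact le_rfl
      · exact le_rfl
      · exact le_rfl
    · intro i; fin_cases i
      · show 2 * k ≤ 4 * k; omega
      · exact le_rfl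
      · show 2 * k ≤ 4 * k; omega
      · show 3 * k ≤ 4 * k; omega
      · exact le_rfl
    · rw [Fin.sum_univ_five]
      show _ = (p₁ / (1 - x)) * TP[k, 2 * k, (x), h]
        + (p₀ / (1 - x)) * TP[0, 4 * k, (x), h]
        + (p₂ - p₁ / (1 - x) * x) * TP[2 * k, 2 * k, (1), h]
        + (p₃) * TP[3 * k, 3 * k, (1), h]
        + (p₄ - p₀ / (1 - x) * x) * TP[4 * k, 4 * k, (1), h]
      field_simp
      ring
    · intro i hi
      clear hi
      fin_cases i
      · show s / 4 ≤ x ∧ s * k ≤ 2 * (k : ℝ) + (((2 * k : ℕ) : ℝ) - (k : ℝ)) * (x)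
        rw [c2k, hx]
        exact ⟨by linarith, by linarith [hsk83]⟩
      · show s / 4 ≤ x ∧ s * k ≤ 2 * ((0 : ℕ) : ℝ) + (((4 * k : ℕ) : ℝ) - ((0 : ℕ) : ℝ)) * (x)
        rw [c4k, hx]
        push_cast
        exact ⟨by linarith, by linarith⟩
      · show s / 4 ≤ 1 ∧ s * k ≤ 2 * ((2 * k : ℕ) : ℝ) + (((2 * k : ℕ) : ℝ) - ((2 * k : ℕ) : ℝ)) * (1)
        rw [c2k]
        exact ⟨by linarith, by linarith [hsk4]⟩
      · show s / 4 ≤ 1 ∧ s * k ≤ 2 * ((3 * k : ℕ) : ℝ) + (((3 * k : ℕ) : ℝ) - ((3 * k : ℕ) : ℝ)) * (1)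
        rw [c3k]
        exact ⟨by linarith, by linarith [hsk4]⟩
      · show s / 4 ≤ 1 ∧ s * k ≤ 2 * ((4 * k : ℕ) : ℝ) + (((4 * k : ℕ) : ℝ) - ((4 * k : ℕ) : ℝ)) * (1)
        rw [c4k]
        exact ⟨by linarith, by linarith [hsk4]⟩
  · have hzf' : (1 - x) * p₄ < x * p₀ := lt_of_not_ge hzf
    have hl3 : 0 ≤ (p₀ - p₄ / x * (1 - x)) / (1 - s / 3) := by
      refine div_nonneg ?_ h13.le
      rw [sub_nonneg, div_mul_eq_mul_div, div_le_iff₀ hx0]; linarith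
    have hr3 : 0 ≤ p₃ - (p₀ - p₄ / x * (1 - x)) / (1 - s / 3) * (s / 3) := by
      have e : (p₀ - p₄ / x * (1 - x)) / (1 - s / 3) * (s / 3) = s * (x * p₀ - (1 - x) * p₄) / ((3 - s) * x) := by
        field_simp
      rw [e, sub_nonneg, div_le_iff₀ (mul_pos h3s hx0)]
      linarith
    refine ⟨Fin 5, inferInstance, ![p₁ / (1 - x), p₄ / x, (p₀ - p₄ / x * (1 - x)) / (1 - s / 3), p₂ - p₁ / (1 - x) * x, p₃ - (p₀ - p₄ / x * (1 - x)) / (1 - s / 3) * (s / 3)],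
      ![x, x, s / 3, 1, 1], ![k, 0, 0, 2 * k, 3 * k], ![2 * k, 4 * k, 3 * k, 2 * k, 3 * k], ?_, ?_, ?_, ?_, ?_, fun h => ?_, ?_⟩
    · intro i; fin_cases i
      · show (0 : ℝ) ≤ p₁ / (1 - x)
        exact div_nonneg hp₁0 h1x.le
      · show (0 : ℝ) ≤ p₄ / x
        exact div_nonneg hp₄0 hx0.le
      · show (0 : ℝ) ≤ (p₀ - p₄ / x * (1 - x)) / (1 - s / 3)
        exact hl3
      · show (0 : ℝ) ≤ p₂ - p₁ / (1 - x) * x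
        exact hr2
      · show (0 : ℝ) ≤ p₃ - (p₀ - p₄ / x * (1 - x)) / (1 - s / 3) * (s / 3)
        exact hr3
    · rw [Fin.sum_univ_five]
      show (p₁ / (1 - x)) + p₄ / x + ((p₀ - p₄ / x * (1 - x)) / (1 - s / 3)) + (p₂ - p₁ / (1 - x) * x) + (p₃ - (p₀ - p₄ / x * (1 - x)) / (1 - s / 3) * (s / 3)) = 1
      have e : (p₁ / (1 - x)) + (p₄ / x) + ((p₀ - p₄ / x * (1 - x)) / (1 - s / 3)) + (p₂ - p₁ / (1 - x) * x) + (p₃ - (p₀ - p₄ / x * (1 - x)) / (1 - s / 3) * (s / 3)) = p₀ + p₁ + p₂ + p₃ + p₄ := by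
        field_simp
        ring
      rw [e, hsum]
    · intro i; fin_cases i
      · show (0 : ℝ) ≤ x ∧ x ≤ 1
        exact ⟨hx0.le, hx1.le⟩
      · show (0 : ℝ) ≤ x ∧ x ≤ 1
        exact ⟨hx0.le, hx1.le⟩
      · show (0 : ℝ) ≤ s / 3 ∧ s / 3 ≤ 1
        exact ⟨by positivity, by linarith⟩
      · show (0 : ℝ) ≤ 1 ∧ 1 ≤ 1
        exact ⟨zero_le_one, le_rfl⟩
      · show (0 : ℝ) ≤ 1 ∧ 1 ≤ 1
        exact ⟨zero_le_one, le_rfl⟩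
    · intro i; fin_cases i
      · show k ≤ 2 * k; omega
      · exact Nat.zero_le _
      · exact Nat.zero_le _
      · exact le_rfl
      · exact le_rfl
    · intro i; fin_cases i
      · show 2 * k ≤ 4 * k; omega
      · exact le_rfl
      · show 3 * k ≤ 4 * k; omega
      · show 2 * k ≤ 4 * k; omega
      · show 3 * k ≤ 4 * k; omega
    · rw [Fin.sum_univ_five]
      show _ = (p₁ / (1 - x)) * TP[k, 2 * k, (x), h]
        + (p₄ / x) * TP[0, 4 * k, (x), h]
        + ((p₀ - p₄ / x * (1 - x)) / (1 - s / 3)) * TP[0, 3 * k, (s / 3), h]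
        + (p₂ - p₁ / (1 - x) * x) * TP[2 * k, 2 * k, (1), h]
        + (p₃ - (p₀ - p₄ / x * (1 - x)) / (1 - s / 3) * (s / 3)) * TP[3 * k, 3 * k, (1), h]
      field_simp
      ring
    · intro i hi
      clear hi
      fin_cases i
      · show s / 4 ≤ x ∧ s * k ≤ 2 * (k : ℝ) + (((2 * k : ℕ) : ℝ) - (k : ℝ)) * (x)
        rw [c2k, hx]
        exact ⟨by linarith, by linarith [hsk83]⟩
      · show s / 4 ≤ x ∧ s * k ≤ 2 * ((0 : ℕ) : ℝ) + (((4 * k : ℕ) : ℝ) - ((0 : ℕ) : ℝ)) * (x)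
        rw [c4k, hx]
        push_cast
        exact ⟨by linarith, by linarith⟩
      · show s / 4 ≤ s / 3 ∧ s * k ≤ 2 * ((0 : ℕ) : ℝ) + (((3 * k : ℕ) : ℝ) - ((0 : ℕ) : ℝ)) * (s / 3)
        rw [c3k]
        push_cast
        exact ⟨by linarith, by linarith⟩
      · show s / 4 ≤ 1 ∧ s * k ≤ 2 * ((2 * k : ℕ) : ℝ) + (((2 * k : ℕ) : ℝ) - ((2 * k : ℕ) : ℝ)) * (1)
        rw [c2k]
        exact ⟨by linarith, by linarith [hsk4]⟩
      · show s / 4 ≤ 1 ∧ s * k ≤ 2 * ((3 * k : ℕ) : ℝ) + (((3 * k : ℕ) : ℝ) - ((3 * k : ℕ) : ℝ)) * (1)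
        rw [c3k]
        exact ⟨by linarith, by linarith [hsk4]⟩

/-! ### Regime `3 ≤ s < 4` -/

/-- regime `3 ≤ s < 4`: the zero ships to `4k` and `k` to `3k`, both at the floor gate; capacity hypotheses `(s/4)p₀ ≤ (1−s/4)p₄`,
`(s/4)p₁ ≤ (1−s/4)p₃`. [this work] -/
theorem heavy_fiveAtoms_r4 (k : ℕ) (p₀ p₁ p₂ p₃ p₄ s : ℝ) (hp₀0 : 0 ≤ p₀) (hp₁0 : 0 ≤ p₁) (hp₂0 : 0 ≤ p₂)
    (_hp₃0 : 0 ≤ p₃) (_hp₄0 : 0 ≤ p₄) (hsum : p₀ + p₁ + p₂ + p₃ + p₄ = 1) (_hmean : p₁ + 2 * p₂ + 3 * p₃ + 4 * p₄ = s) (hs0 : 0 < s) (_h3 : 3 ≤ s) (h4 : s < 4)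
    (hA : s / 4 * p₀ ≤ (1 - s / 4) * p₄) (hS : s / 4 * p₁ ≤ (1 - s / 4) * p₃) :
    ∃ (ι : Type) (_ : Fintype ι) (lam γ : ι → ℝ) (lo hi : ι → ℕ),
      (∀ i, 0 ≤ lam i) ∧ (∑ i, lam i = 1) ∧ (∀ i, 0 ≤ γ i ∧ γ i ≤ 1) ∧ (∀ i, lo i ≤ hi i) ∧ (∀ i, hi i ≤ 4 * k) ∧
      (∀ h, (p₀ * (if h = 0 then (1 : ℝ) else 0) + p₁ * (if h = k then (1 : ℝ) else 0) + p₂ * (if h = 2 * k then (1 : ℝ) else 0)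
          + p₃ * (if h = 3 * k then (1 : ℝ) else 0) + p₄ * (if h = 4 * k then (1 : ℝ) else 0)) = ∑ i, lam i * TP[lo i, hi i, γ i, h]) ∧
      (∀ i, 0 < lam i → s / 4 ≤ γ i ∧ s * k ≤ 2 * (lo i : ℝ) + ((hi i : ℝ) - lo i) * γ i) := by
  have hk0 : (0 : ℝ) ≤ k := Nat.cast_nonneg k
  have hsne : s ≠ 0 := hs0.ne'
  have c2k : ((2 * k : ℕ) : ℝ) = 2 * (k : ℝ) := by push_cast; ring
  have c3k : ((3 * k : ℕ) : ℝ) = 3 * (k : ℝ) := by push_cast; ring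
  have c4k : ((4 * k : ℕ) : ℝ) = 4 * (k : ℝ) := by push_cast; ring
  obtain ⟨x, hx⟩ : ∃ x : ℝ, x = s / 4 := ⟨_, rfl⟩
  have hx0 : 0 < x := by rw [hx]; positivity
  have hx1 : x < 1 := by rw [hx]; linarith
  have h1x : 0 < 1 - x := by linarith
  have hxne : x ≠ 0 := hx0.ne'
  have h1xne : 1 - x ≠ 0 := h1x.ne'
  have hsk4 : s * (k : ℝ) ≤ 4 * k := mul_le_mul_of_nonneg_right (by linarith : s ≤ 4) hk0
  rw [← hx] at hA hS
  have hr3 : 0 ≤ p₃ - p₁ / (1 - x) * x := by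
    rw [sub_nonneg, div_mul_eq_mul_div, div_le_iff₀ h1x]; linarith
  have hr4 : 0 ≤ p₄ - p₀ / (1 - x) * x := by
    rw [sub_nonneg, div_mul_eq_mul_div, div_le_iff₀ h1x]; linarith
  refine ⟨Fin 5, inferInstance, ![p₀ / (1 - x), p₁ / (1 - x), p₂, p₃ - p₁ / (1 - x) * x, p₄ - p₀ / (1 - x) * x],
    ![x, x, 1, 1, 1], ![0, k, 2 * k, 3 * k, 4 * k], ![4 * k, 3 * k, 2 * k, 3 * k, 4 * k], ?_, ?_, ?_, ?_, ?_, fun h => ?_, ?_⟩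
  · intro i; fin_cases i
    · show (0 : ℝ) ≤ p₀ / (1 - x)
      exact div_nonneg hp₀0 h1x.le
    · show (0 : ℝ) ≤ p₁ / (1 - x)
      exact div_nonneg hp₁0 h1x.le
    · show (0 : ℝ) ≤ p₂
      exact hp₂0
    · show (0 : ℝ) ≤ p₃ - p₁ / (1 - x) * x
      exact hr3
    · show (0 : ℝ) ≤ p₄ - p₀ / (1 - x) * x
      exact hr4
  · rw [Fin.sum_univ_five]
    show (p₀ / (1 - x)) + (p₁ / (1 - x)) + p₂ + (p₃ - p₁ / (1 - x) * x) + (p₄ - p₀ / (1 - x) * x) = 1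
    have e : (p₀ / (1 - x)) + (p₁ / (1 - x)) + (p₂) + (p₃ - p₁ / (1 - x) * x) + (p₄ - p₀ / (1 - x) * x) = p₀ + p₁ + p₂ + p₃ + p₄ := by
      field_simp
      ring
    rw [e, hsum]
  · intro i; fin_cases i
    · show (0 : ℝ) ≤ x ∧ x ≤ 1
      exact ⟨hx0.le, hx1.le⟩
    · show (0 : ℝ) ≤ x ∧ x ≤ 1
      exact ⟨hx0.le, hx1.le⟩
    · show (0 : ℝ) ≤ 1 ∧ 1 ≤ 1
      exact ⟨zero_le_one, le_rfl⟩
    · show (0 : ℝ) ≤ 1 ∧ 1 ≤ 1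
      exact ⟨zero_le_one, le_rfl⟩
    · show (0 : ℝ) ≤ 1 ∧ 1 ≤ 1
      exact ⟨zero_le_one, le_rfl⟩
  · intro i; fin_cases i
    · exact Nat.zero_le _
    · show k ≤ 3 * k; omega
    · exact le_rfl
    · exact le_rfl
    · exact le_rfl
  · intro i; fin_cases i
    · exact le_rfl
    · show 3 * k ≤ 4 * k; omega
    · show 2 * k ≤ 4 * k; omega
    · show 3 * k ≤ 4 * k; omega
    · exact le_rfl
  · rw [Fin.sum_univ_five]
    show _ = (p₀ / (1 - x)) * TP[0, 4 * k, (x), h]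
      + (p₁ / (1 - x)) * TP[k, 3 * k, (x), h]
      + (p₂) * TP[2 * k, 2 * k, (1), h]
      + (p₃ - p₁ / (1 - x) * x) * TP[3 * k, 3 * k, (1), h]
      + (p₄ - p₀ / (1 - x) * x) * TP[4 * k, 4 * k, (1), h]
    field_simp
    ring
  · intro i hi
    clear hi
    fin_cases i
    · show s / 4 ≤ x ∧ s * k ≤ 2 * ((0 : ℕ) : ℝ) + (((4 * k : ℕ) : ℝ) - ((0 : ℕ) : ℝ)) * (x)
      rw [c4k, hx]
      push_cast
      exact ⟨by linarith, by linarith⟩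
    · show s / 4 ≤ x ∧ s * k ≤ 2 * (k : ℝ) + (((3 * k : ℕ) : ℝ) - (k : ℝ)) * (x)
      rw [c3k, hx]
      exact ⟨by linarith, by linarith [hsk4]⟩
    · show s / 4 ≤ 1 ∧ s * k ≤ 2 * ((2 * k : ℕ) : ℝ) + (((2 * k : ℕ) : ℝ) - ((2 * k : ℕ) : ℝ)) * (1)
      rw [c2k]
      exact ⟨by linarith, by linarith [hsk4]⟩
    · show s / 4 ≤ 1 ∧ s * k ≤ 2 * ((3 * k : ℕ) : ℝ) + (((3 * k : ℕ) : ℝ) - ((3 * k : ℕ) : ℝ)) * (1)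
      rw [c3k]
      exact ⟨by linarith, by linarith [hsk4]⟩
    · show s / 4 ≤ 1 ∧ s * k ≤ 2 * ((4 * k : ℕ) : ℝ) + (((4 * k : ℕ) : ℝ) - ((4 * k : ℕ) : ℝ)) * (1)
      rw [c4k]
      exact ⟨by linarith, by linarith [hsk4]⟩

end LawDec
end Quant
end Summit.CriticalPhenomena.PercolationContinuityZ3.Theorems
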